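import Summits.BirchSwinnertonDyer.BirchSwinnertonDyer.Theorems.GoldfeldAllTwistsTwoConverseTwinQuarterTraceCore
import Mathlib.GroupTheory.OrderOfElement
import HarnessLib

set_option linter.dupNamespace false -- namespace `…BirchSwinnertonDyer.BirchSwinnertonDyer…` is the cell's (D-0017 nested layout)
set_option autoImplicit false

/-!
# LINE C3⁺ (PHASE 2), file P2a′: the QUARTER-TRACE CORE on a SUBGROUP, with odd multipliers and torsion error terms absorbed
# (the form the assembly of THEOREM A⁗ consumes; FACT-FREE)

Cell `bsd-goldfeld`, seat `bsd-goldfeld-s1p-c3x` (gen 7); planner ORDER (ccxxix)/(ccxxxi) «LINE C3⁺», file P2a′ (the announced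
"`quarterTrace_parity_of_four_dvd` variant" of P2a, memo §5′ P2g). `--supports stmt-BirchSwinnertonDyer-20044` as a HELPER. Theses-free,
Literature-free; theorems only, about an ABSTRACT abelian group; no `sorry`.

WHY A SECOND CORE. In the assembly the ambient group is `M = X₀(49)(ℂ)` (all Heegner points of `K[1]` and of the partner field's
`ℚ(√−qp)[1]` are compared there, both ring class fields being subfields of `ℂ`), where `M[4] = {0, T}` FAILS; it holds on the subgroup
`B = X₀(49)(J)`, `J = ℚ(√2, √−q, √p)` the genus field of `K` (P2f), which contains every point of the bookkeeping. Also the partner files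
deliver ODD multiples (`M_q•P_q = (4m)•Y + t_q`, …) with TORSION error terms `t_•` (not literally in `{0, T}`), and the `χ_q` relation already
comes with `n = 4m` (height ratio `16ρ`, P2c), so the level-one half trace `Ψ_q` of P2a is not needed.

THE STATEMENT (`not_isOfFinAddOrder_of_quarterTrace_subgroup`). `M` abelian, `B ≤ M`, `c : M →+ M`, `T ∈ M` with `2T = 0`, `T ≠ 0`, `cT = T`;
on `B`: `4x = 0 ⇒ x ∈ {0,T}` and every torsion `u ∈ B` has an ODD multiple in `{0, T}`. Data in `M` with `Ψ, y, Y, R_e, R_p, t_e, t_q, t_p ∈ B`: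
`4Ψ = y + P_e + P_q + P_p`, `cΨ + Ψ = κT`; `M_e•P_e = 4R_e + t_e`, `cR_e + R_e = ε_eT`; `M_p•P_p = 4R_p + t_p`, `cR_p + R_p = ε_pT`;
`M_q•P_q = (4m)•Y + t_q`, `cY + Y = ε_qT`; `M_e, M_q, M_p` odd; `t_e, t_q, t_p` torsion. CONCLUSION: if `κ − ε_e − ε_p − mε_q` is ODD then
**`y` has infinite order**. (Proof: were `y` torsion, multiply everything by a common odd `N` killing the torsion terms into `{0,T}`; then
`Z = NΨ − N_eR_e − N_q m Y − N_pR_p ∈ B` has `4Z ∈ {0,T}`, so `Z ∈ {0,T}`, so `(c+1)Z = 0`, which reads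
`(Nκ − N_eε_e − N_q mε_q − N_pε_p)•T = 0` with `N, N_e, N_q, N_p` odd — a parity contradiction.)
HONEST FRAMING: pure group algebra; no Heegner point is constructed here and no case of K12₂″ / twin″ is decided; BSD is not proved.

References: [Gross1984] §§4–5; [GrossLMS1991] Prop. 5.3; [CoatesLiTianZhai2015] Thm. 2.5. -/

namespace Summit.BirchSwinnertonDyer.BirchSwinnertonDyer.Theorems.GoldfeldGoodTwists

section QuarterTraceSubgroup

variable {M : Type*} [AddCommGroup M]

/-- From `4 • Z ∈ {0, T}`, `Z ∈ B` and `B[4] = {0, T}`: `Z ∈ {0, T}` (subgroup form of `mem_of_four_zsmul_mem`). [folklore] -/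
theorem mem_of_four_zsmul_mem_subgroup (B : AddSubgroup M) {T Z : M} (hT2 : 2 • T = 0) (hT0 : T ≠ 0)
    (h4 : ∀ x ∈ B, (4 : ℤ) • x = 0 → x = 0 ∨ x = T) (hZB : Z ∈ B) (hZ : (4 : ℤ) • Z = 0 ∨ (4 : ℤ) • Z = T) :
    Z = 0 ∨ Z = T := by
  have hT2z : (2 : ℤ) • T = 0 := by exact_mod_cast hT2
  rcases hZ with h0 | hT
  · exact h4 Z hZB h0
  · exfalso
    have h8 : (4 : ℤ) • ((2 : ℤ) • Z) = 0 := by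
      rw [← mul_zsmul, show (4 * 2 : ℤ) = 2 * 4 by norm_num, mul_zsmul, hT, hT2z]
    have h4Z : (4 : ℤ) • Z = (2 : ℤ) • ((2 : ℤ) • Z) := by rw [← mul_zsmul]; norm_num
    rcases h4 _ (B.zsmul_mem hZB 2) h8 with h0 | h1
    · apply hT0; rw [← hT, h4Z, h0, zsmul_zero]
    · apply hT0; rw [← hT, h4Z, h1, hT2z]

/-- An odd multiple of an odd multiple in `{0, T}` stays in `{0, T}`: bookkeeping helper. [folklore] -/
theorem zsmul_mem_pair_of_zsmul_mem_pair {T u : M} (hT2 : 2 • T = 0) {n : ℤ} (hn : n • u = 0 ∨ n • u = T) (k : ℤ) :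
    (k * n) • u = 0 ∨ (k * n) • u = T := by
  rw [mul_zsmul]
  exact zsmul_mem_zero_or_twoTorsion hT2 hn k

/-- **THE QUARTER-TRACE CORE ON A SUBGROUP (odd multipliers, torsion error terms).** See the module docstring: if
`κ − ε_e − ε_p − m·ε_q` is odd, the point `y` (the full Galois trace of the conductor-one Heegner point) has infinite order.
[cite: CoatesLiTianZhai2015, Thm. 2.5 (the half-trace device)] [cite: GrossLMS1991, Prop. 5.3] -/
theorem not_isOfFinAddOrder_of_quarterTrace_subgroup (c : M →+ M) (B : AddSubgroup M) {T : M} (hT2 : 2 • T = 0) (hT0 : T ≠ 0)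
    (h4 : ∀ x ∈ B, (4 : ℤ) • x = 0 → x = 0 ∨ x = T)
    (hodd : ∀ u ∈ B, IsOfFinAddOrder u → ∃ n : ℤ, Odd n ∧ (n • u = 0 ∨ n • u = T)) (hcT : c T = T)
    {Ψ y Pe Pq Pp Y Re Rp te tq tp : M} {κ εe εp εq m Me Mq Mp : ℤ}
    (hΨB : Ψ ∈ B) (hyB : y ∈ B) (hYB : Y ∈ B) (hReB : Re ∈ B) (hRpB : Rp ∈ B) (hteB : te ∈ B) (htqB : tq ∈ B) (htpB : tp ∈ B)
    (hMe : Odd Me) (hMq : Odd Mq) (hMp : Odd Mp)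
    (hΨ : (4 : ℤ) • Ψ = y + Pe + Pq + Pp) (hcΨ : c Ψ + Ψ = κ • T)
    (hPe : Me • Pe = (4 : ℤ) • Re + te) (hRe : c Re + Re = εe • T) (hte : IsOfFinAddOrder te)
    (hPp : Mp • Pp = (4 : ℤ) • Rp + tp) (hRp : c Rp + Rp = εp • T) (htp : IsOfFinAddOrder tp)
    (hPq : Mq • Pq = (4 * m) • Y + tq) (hY : c Y + Y = εq • T) (htq : IsOfFinAddOrder tq)
    (hpar : Odd (κ - εe - εp - m * εq)) :
    ¬ IsOfFinAddOrder y := by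
  intro hytors
  have hT2z : (2 : ℤ) • T = 0 := by exact_mod_cast hT2
  ------------------------------------------------------------------ odd multipliers killing the torsion terms into `{0, T}`
  obtain ⟨ny, hny, hnyu⟩ := hodd y hyB hytors
  obtain ⟨ne, hne, hneu⟩ := hodd te hteB hte
  obtain ⟨nq, hnq, hnqu⟩ := hodd tq htqB htq
  obtain ⟨np, hnp, hnpu⟩ := hodd tp htpB htp
  -- the common odd multiplier and its three quotients
  set n₀ : ℤ := ny * ne * nq * np with hn₀
  have hn₀odd : Odd n₀ := ((hny.mul hne).mul hnq).mul hnp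
  set N : ℤ := n₀ * (Me * Mq * Mp) with hN
  set Ne : ℤ := n₀ * (Mq * Mp) with hNe
  set Nq : ℤ := n₀ * (Me * Mp) with hNq
  set Np : ℤ := n₀ * (Me * Mq) with hNp
  have hNodd : Odd N := hn₀odd.mul ((hMe.mul hMq).mul hMp)
  have hNeodd : Odd Ne := hn₀odd.mul (hMq.mul hMp)
  have hNqodd : Odd Nq := hn₀odd.mul (hMe.mul hMp)
  have hNpodd : Odd Np := hn₀odd.mul (hMe.mul hMq)
  have hNe' : N = Ne * Me := by rw [hN, hNe]; ring
  have hNq' : N = Nq * Mq := by rw [hN, hNq]; ring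
  have hNp' : N = Np * Mp := by rw [hN, hNp]; ring
  -- the four torsion terms, multiplied, lie in `{0, T}`
  have hy' : N • y = 0 ∨ N • y = T := by
    rw [show N = (ne * nq * np * (Me * Mq * Mp)) * ny by rw [hN, hn₀]; ring]
    exact zsmul_mem_pair_of_zsmul_mem_pair hT2 hnyu _
  have hte' : Ne • te = 0 ∨ Ne • te = T := by
    rw [show Ne = (ny * nq * np * (Mq * Mp)) * ne by rw [hNe, hn₀]; ring]
    exact zsmul_mem_pair_of_zsmul_mem_pair hT2 hneu _
  have htq' : Nq • tq = 0 ∨ Nq • tq = T := by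
    rw [show Nq = (ny * ne * np * (Me * Mp)) * nq by rw [hNq, hn₀]; ring]
    exact zsmul_mem_pair_of_zsmul_mem_pair hT2 hnqu _
  have htp' : Np • tp = 0 ∨ Np • tp = T := by
    rw [show Np = (ny * ne * nq * (Me * Mq)) * np by rw [hNp, hn₀]; ring]
    exact zsmul_mem_pair_of_zsmul_mem_pair hT2 hnpu _
  ------------------------------------------------------------------ `Z := NΨ − Ne•Re − (Nq m)•Y − Np•Rp`, `4Z ∈ {0,T}`
  have hZ4 : (4 : ℤ) • (N • Ψ - Ne • Re - (Nq * m) • Y - Np • Rp) = N • y + Ne • te + Nq • tq + Np • tp := by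
    have e1 : (4 : ℤ) • (N • Ψ) = N • y + Ne • (Me • Pe) + Nq • (Mq • Pq) + Np • (Mp • Pp) := by
      rw [smul_comm, hΨ, zsmul_add, zsmul_add, zsmul_add, smul_smul Ne Me, smul_smul Nq Mq, smul_smul Np Mp, ← hNe', ← hNq',
        ← hNp']
    rw [zsmul_sub, zsmul_sub, zsmul_sub, e1, hPe, hPq, hPp]
    simp only [zsmul_add, smul_smul]
    rw [show Nq * (4 * m) = 4 * (Nq * m) by ring, show Ne * 4 = 4 * Ne by ring, show Np * 4 = 4 * Np by ring]
    simp only [mul_zsmul]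
    abel
  have hsum : N • y + Ne • te + Nq • tq + Np • tp = 0 ∨ N • y + Ne • te + Nq • tq + Np • tp = T :=
    add_mem_zero_or_twoTorsion hT2 (add_mem_zero_or_twoTorsion hT2 (add_mem_zero_or_twoTorsion hT2 hy' hte') htq') htp'
  have hZB : N • Ψ - Ne • Re - (Nq * m) • Y - Np • Rp ∈ B :=
    B.sub_mem (B.sub_mem (B.sub_mem (B.zsmul_mem hΨB N) (B.zsmul_mem hReB Ne)) (B.zsmul_mem hYB _)) (B.zsmul_mem hRpB Np)
  have hZmem : N • Ψ - Ne • Re - (Nq * m) • Y - Np • Rp = 0 ∨ N • Ψ - Ne • Re - (Nq * m) • Y - Np • Rp = T :=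
    mem_of_four_zsmul_mem_subgroup B hT2 hT0 h4 hZB (by rw [hZ4]; exact hsum)
  ------------------------------------------------------------------ `(c + 1)Z = 0` read as a parity
  have hpar0 : (N * κ - Ne * εe - Nq * m * εq - Np * εp) • T = 0 := by
    have h1 := map_add_self_eq_zero_of_mem c hT2 hcT hZmem
    rw [map_sub, map_sub, map_sub, map_zsmul, map_zsmul, map_zsmul, map_zsmul] at h1
    have h2 : N • (c Ψ + Ψ) - Ne • (c Re + Re) - (Nq * m) • (c Y + Y) - Np • (c Rp + Rp) = 0 := by
      rw [zsmul_add, zsmul_add, zsmul_add, zsmul_add, ← h1]; abel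
    rw [hcΨ, hRe, hY, hRp, smul_smul, smul_smul, smul_smul, smul_smul] at h2
    rw [sub_smul, sub_smul, sub_smul]
    rw [show Nq * m * εq = (Nq * m) * εq by ring]
    exact h2
  have heven : Even (N * κ - Ne * εe - Nq * m * εq - Np * εp) := (zsmul_twoTorsion_eq_zero_iff hT2 hT0 _).mp hpar0
  -- parity bookkeeping: `N, Ne, Nq, Np` odd
  obtain ⟨a, ha⟩ := hNodd
  obtain ⟨b, hb⟩ := hNeodd
  obtain ⟨c', hc'⟩ := hNqodd
  obtain ⟨d', hd'⟩ := hNpodd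
  obtain ⟨k, hk⟩ := hpar
  obtain ⟨r, hr⟩ := heven
  have key : N * κ - Ne * εe - Nq * m * εq - Np * εp =
      (κ - εe - εp - m * εq) + 2 * (a * κ - b * εe - c' * m * εq - d' * εp) := by
    rw [ha, hb, hc', hd']; ring
  rw [key, hk] at hr
  omega

end QuarterTraceSubgroup

end Summit.BirchSwinnertonDyer.BirchSwinnertonDyer.Theorems.GoldfeldGoodTwists
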